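import Literature.NumberTheory.Automorphic.Liu2021.AppendixC.AlbaneseFiniteQuotientTrace
import Literature.AlgebraicGeometry.Motives.TorsorCoproductQuotient
import HarnessLib

/-!
# Factoring homomorphisms out of `Alb_X` through `Alb_p` ⟺ descending `∇`-morphisms along `∇p`
# (the formal reduction of the Albanese trace of a finite quotient to a descent along `∇p`)

[Liu2021] = Yifeng Liu, *Fourier–Jacobi cycles and arithmetic relative trace formula*, Camb. J. Math. **9** (2021);
carriers `AppendixC.Nabla` / `AppendixC.Albanese` (Def. 2.1 (1), Def. 2.3, `AppendixC/Glue.lean`), kernel functoriality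
`Nabla.map` / `Albanese.map` (`AppendixC/AlbaneseFunctorial.lean`), the quotient predicate `Motives.IsSepQuotient`
(`Motives/SeparatedQuotient.lean`, API in `Motives/TorsorCoproductQuotient.lean`) and the NAMED FACT
`AlbaneseTraceOfFiniteQuotient` (`AppendixC/AlbaneseFiniteQuotientTrace.lean`, [Lang1983AbelianVarieties] VIII §6).
PROOF FILE (theorems only; no definition, no named fact, no instance).  Cell hodgecm-mathlib, fan B, row VI-4.
HC_CM is proved only modulo the 7 printed citations until rung 0 closes; this file discharges nothing by itself.

THE REDUCTION.  Let `p : X ⟶ Y` be a `k`-morphism which is an epimorphism against the abelian variety `B` (e.g. a quotient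
for separated test objects, `IsSepQuotient act p`), `aX`, `aY` Albanese data, `e : Alb_X ⟶ B` a homomorphism.  Then
`e` FACTORS THROUGH `Alb_p` (`∃ t : Alb_Y ⟶ B, Alb_p ≫ t = e`) IF AND ONLY IF the `∇`-morphism `α_X ≫ e : ∇X → B` DESCENDS
ALONG `∇p : ∇X → ∇Y` (`∃ f : ∇Y → B, ∇p ≫ f = α_X ≫ e`): «only if» by the printed identity `α_X ≫ Alb_p = ∇p ≫ α_Y`
(Def. 2.3), «if» by the corepresentability of `Alb_Y` — the descended `f` kills the diagonal `ΔY` because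
`p ≫ ΔY ≫ f = ΔX ≫ ∇p ≫ f = ΔX ≫ α_X ≫ e = 0` and `p` cancels — and the uniqueness half for `Alb_X`
(`Albanese.exists_map_comp_eq_iff_exists_nabla_desc`).  With `e := Σ_{g ∈ Δ} Alb_{act g}` this says: the Albanese TRACE
of [Lang1983AbelianVarieties, VIII §6, proof of Thm. 13] (`t = h_*` with `Alb_p ≫ t = Σ_g Alb_g`) exists iff the morphism
`α_X ≫ Σ_g Alb_{act g} = Π_g (∇(act g) ≫ α_X)` descends along `∇p` — so the named fact `AlbaneseTraceOfFiniteQuotient`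
follows from (and is equivalent to) the pure descent statement (`albaneseTraceOfFiniteQuotient_of_nabla_desc`,
`nabla_desc_of_albaneseTraceOfFiniteQuotient`).  The descent itself (Lang's `h`, a sum over the fibres of `p`) is the
geometric content and is NOT proved here: `∇p` is not a quotient of `∇X` by the diagonal action of `Δ` (for `X = E` an
elliptic curve and `Δ = {±1}`, `(E × E)/± → ℙ¹ × ℙ¹ = ∇(E/±)` has degree 2), so `IsSepQuotient` does not apply to it.
-/

set_option autoImplicit false

noncomputable section

open CategoryTheory AlgebraicGeometry
open Literature.AlgebraicGeometry.Motives (SchemeOver AbelianVariety IsProjectiveOver IsSepQuotient)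

namespace Literature.NumberTheory.Automorphic.Liu2021.AppendixC

universe u

namespace Albanese

open scoped MonObj

variable {k : Type u} [Field k] {X Y : SchemeOver k}

/-- **«Only if»: a factorisation through `Alb_p` descends the `∇`-morphism.**  If `Alb_p ≫ t = e` then
`f := α_Y ≫ t : ∇Y → B` satisfies `∇p ≫ f = α_X ≫ e`, by the printed identity `α_X ≫ Alb_p = ∇p ≫ α_Y` of Def. 2.3.
[cite: Liu2021, Def. 2.3, l. 1202–1208] -/
theorem nablaMap_comp_α_comp_eq (aX : Albanese X) (aY : Albanese Y) (p : X ⟶ Y) {B : AbelianVariety k}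
    (e : aX.Alb ⟶ B) (t : aY.Alb ⟶ B) (ht : aX.map aY p ≫ t = e) :
    aX.nabla.map aY.nabla p ≫ (aY.α ≫ t.hom.hom.hom) = aX.α ≫ e.hom.hom.hom := by
  have hc : (aX.map aY p ≫ t).hom.hom.hom = (aX.map aY p).hom.hom.hom ≫ t.hom.hom.hom := rfl
  rw [← ht, hc]
  exact (aX.α_map_assoc aY p _).symm

/-- **«If»: a descent of `α_X ≫ e` along `∇p` factors `e` through `Alb_p`**, provided `p` cancels against `B`-valued
morphisms (`p ≫ a = p ≫ b → a = b`; e.g. `p` a quotient for separated test objects).  The descended `f : ∇Y → B` kills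
`ΔY` (`p ≫ ΔY ≫ f = ΔX ≫ ∇p ≫ f = ΔX ≫ α_X ≫ e = 0`, cancel `p`), so `t := desc f : Alb_Y ⟶ B` exists with `α_Y ≫ t = f`
(corepresentability of `Alb_Y`, Def. 2.3), and `Alb_p ≫ t = e` by the uniqueness half for `Alb_X`
(`α_X ≫ Alb_p ≫ t = ∇p ≫ α_Y ≫ t = ∇p ≫ f = α_X ≫ e`). [cite: Liu2021, Def. 2.3 and the Proposition before it, l. 1190–1208] -/
theorem exists_map_comp_eq_of_nabla_desc (aX : Albanese X) (aY : Albanese Y) (p : X ⟶ Y) {B : AbelianVariety k}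
    (hp : ∀ {a b : Y ⟶ B.X}, p ≫ a = p ≫ b → a = b) (e : aX.Alb ⟶ B) (f : aY.nabla.N ⟶ B.X)
    (hf : aX.nabla.map aY.nabla p ≫ f = aX.α ≫ e.hom.hom.hom) :
    ∃ t : aY.Alb ⟶ B, aX.map aY p ≫ t = e := by
  have hdiag : aY.nabla.diag ≫ f = 1 := by
    apply hp
    rw [← Category.assoc, ← Nabla.diag_map aX.nabla aY.nabla p, Category.assoc, hf, ← Category.assoc, aX.diag_α,
      MonObj.one_comp, MonObj.comp_one]
  refine ⟨aY.desc f hdiag, aX.hom_ext _ _ ?_⟩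
  have hc : (aX.map aY p ≫ aY.desc f hdiag).hom.hom.hom = (aX.map aY p).hom.hom.hom ≫ (aY.desc f hdiag).hom.hom.hom := rfl
  rw [hc, ← Category.assoc, aX.α_map, Category.assoc, aY.fac, hf]

/-- **Factoring through `Alb_p` ⟺ descending along `∇p`** (for `p` cancelling against `B`): `∃ t, Alb_p ≫ t = e` iff
`∃ f : ∇Y → B, ∇p ≫ f = α_X ≫ e`. [cite: Liu2021, Def. 2.3 and the Proposition before it, l. 1190–1208] -/
theorem exists_map_comp_eq_iff_exists_nabla_desc (aX : Albanese X) (aY : Albanese Y) (p : X ⟶ Y) {B : AbelianVariety k}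
    (hp : ∀ {a b : Y ⟶ B.X}, p ≫ a = p ≫ b → a = b) (e : aX.Alb ⟶ B) :
    (∃ t : aY.Alb ⟶ B, aX.map aY p ≫ t = e) ↔
      ∃ f : aY.nabla.N ⟶ B.X, aX.nabla.map aY.nabla p ≫ f = aX.α ≫ e.hom.hom.hom :=
  ⟨fun ⟨t, ht⟩ => ⟨aY.α ≫ t.hom.hom.hom, nablaMap_comp_α_comp_eq aX aY p e t ht⟩,
    fun ⟨f, hf⟩ => exists_map_comp_eq_of_nabla_desc aX aY p hp e f hf⟩

/-- A quotient map for separated test objects cancels against morphisms to (the scheme of) an abelian variety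
(abelian varieties are proper, hence separated, over `k`; `IsSepQuotient.hom_ext`). [cite: MumfordAV1970, §7 Thm. p. 66 (Remark)] -/
theorem _root_.Literature.AlgebraicGeometry.Motives.IsSepQuotient.cancel_abelianVariety {Δ : Type*}
    {act : Δ → (X ≅ X)} {p : X ⟶ Y} (h : IsSepQuotient act p) (B : AbelianVariety k) {a b : Y ⟶ B.X}
    (hab : p ≫ a = p ≫ b) : a = b :=
  h.hom_ext (inferInstance : IsSeparated B.X.hom) hab

/-- **The trace exists iff `α_X ≫ Σ_g Alb_{act g}` descends along `∇p`**, for `p : X ⟶ Y` a quotient of `X` by the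
`act g` for separated test objects: Lang's `h_* : A(V) → A(U)` with `h_* f_* = Σ_g g_*` ([Lang1983AbelianVarieties] VIII §6,
proof of Thm. 13, `h(v) = Σ_i φ_U(P_i)`) is, in Liu's base-point-free language, EXACTLY a descent of the `∇`-morphism
`α_X ≫ Σ_g Alb_g` (`= Π_g ∇(act g) ≫ α_X` in the group of `∇X`-valued points of `Alb_X`) to `∇Y`.
[cite: Lang1983AbelianVarieties, Ch. VIII §6 Thm. 13 (proof: the homomorphism h_*)] [cite: Liu2021, Def. 2.3] -/
theorem exists_trace_iff_exists_nabla_desc (aX : Albanese X) (aY : Albanese Y) {Δ : Type*} [Fintype Δ]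
    (act : Δ → (X ≅ X)) (p : X ⟶ Y) (hp : IsSepQuotient act p) :
    (∃ t : aY.Alb ⟶ aX.Alb, aX.map aY p ≫ t = ∑ g, aX.map aX (act g).hom) ↔
      ∃ f : aY.nabla.N ⟶ aX.Alb.X,
        aX.nabla.map aY.nabla p ≫ f = aX.α ≫ (∑ g, aX.map aX (act g).hom).hom.hom.hom :=
  exists_map_comp_eq_iff_exists_nabla_desc aX aY p (fun hab => hp.cancel_abelianVariety aX.Alb hab) _

/-- The `∇`-morphism to be descended is `Δ`-INVARIANT for the diagonal action `∇(act h)` on `∇X` when `act` is a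
homomorphism: `∇(act h) ≫ (α_X ≫ Σ_g Alb_{act g}) = α_X ≫ Σ_g Alb_{act g}` (reindex `g ↦ g h`; `∇(act h) ≫ α_X =
α_X ≫ Alb_{act h}`).  Necessary for the descent, NOT sufficient (`∇p` is not the quotient of `∇X` by this action).
[cite: Lang1983AbelianVarieties, Ch. VIII §6 Thm. 13 (proof)] [cite: Liu2021, Def. 2.1 (1), Def. 2.3] -/
theorem nablaMap_comp_α_comp_sum_map (aX : Albanese X) {Δ : Type*} [Group Δ] [Fintype Δ] (act : Δ →* Aut X) (h : Δ) :
    aX.nabla.map aX.nabla (act h).hom ≫ (aX.α ≫ (∑ g, aX.map aX (act g).hom).hom.hom.hom) =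
      aX.α ≫ (∑ g, aX.map aX (act g).hom).hom.hom.hom := by
  have key : aX.map aX (act h).hom ≫ (∑ g, aX.map aX (act g).hom) = ∑ g, aX.map aX (act g).hom := by
    rw [Preadditive.comp_sum]
    refine Fintype.sum_equiv (Equiv.mulRight h) _ _ fun g => ?_
    rw [Equiv.coe_mulRight, ← Albanese.map_comp, map_mul]
    rfl
  have hc : ∀ a b : aX.Alb ⟶ aX.Alb, (a ≫ b).hom.hom.hom = a.hom.hom.hom ≫ b.hom.hom.hom := fun _ _ => rfl
  rw [← Category.assoc, ← aX.α_map aX (act h).hom, Category.assoc, ← hc, key]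

/-- **The named fact from the descent statement**: if for all the data of `AlbaneseTraceOfFiniteQuotient` the
`∇`-morphism `α_X ≫ Σ_g Alb_{act g}` descends along `∇p`, then `AlbaneseTraceOfFiniteQuotient` holds.
[cite: Lang1983AbelianVarieties, Ch. VIII §6 Thm. 13 (proof: the homomorphism h_*)] -/
theorem albaneseTraceOfFiniteQuotient_of_nabla_desc
    (H : ∀ (k : Type u) [Field k] [CharZero k] (X Y : SchemeOver k) (dX dY : ℕ)
      [SmoothOfRelativeDimension dX X.hom] [SmoothOfRelativeDimension dY Y.hom],
      IsProjectiveOver X → IsProjectiveOver Y →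
      ∀ (Δ : Type u) [Group Δ] [Fintype Δ] (act : Δ →* Aut X) (p : X ⟶ Y),
        IsSepQuotient (fun g => act g) p →
        ∀ (aX : Albanese X) (aY : Albanese Y),
          ∃ f : aY.nabla.N ⟶ aX.Alb.X,
            aX.nabla.map aY.nabla p ≫ f = aX.α ≫ (∑ g : Δ, aX.map aX (act g).hom).hom.hom.hom) :
    AlbaneseTraceOfFiniteQuotient.{u} := by
  intro k _ _ X Y dX dY _ _ hX hY Δ _ _ act p hp aX aY
  exact (exists_trace_iff_exists_nabla_desc aX aY (fun g => act g) p hp).2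
    (H k X Y dX dY hX hY Δ act p hp aX aY)

/-- **Conversely**, `AlbaneseTraceOfFiniteQuotient` gives the descent of `α_X ≫ Σ_g Alb_{act g}` along `∇p` for all its
data. [cite: Lang1983AbelianVarieties, Ch. VIII §6 Thm. 13 (proof: the homomorphism h_*)] -/
theorem nabla_desc_of_albaneseTraceOfFiniteQuotient (hT : AlbaneseTraceOfFiniteQuotient.{u})
    (k : Type u) [Field k] [CharZero k] (X Y : SchemeOver k) (dX dY : ℕ)
    [SmoothOfRelativeDimension dX X.hom] [SmoothOfRelativeDimension dY Y.hom]
    (hX : IsProjectiveOver X) (hY : IsProjectiveOver Y)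
    (Δ : Type u) [Group Δ] [Fintype Δ] (act : Δ →* Aut X) (p : X ⟶ Y)
    (hp : IsSepQuotient (fun g => act g) p) (aX : Albanese X) (aY : Albanese Y) :
    ∃ f : aY.nabla.N ⟶ aX.Alb.X,
      aX.nabla.map aY.nabla p ≫ f = aX.α ≫ (∑ g : Δ, aX.map aX (act g).hom).hom.hom.hom :=
  (exists_trace_iff_exists_nabla_desc aX aY (fun g => act g) p hp).1
    (hT k X Y dX dY hX hY Δ act p hp aX aY)

end Albanese

end Literature.NumberTheory.Automorphic.Liu2021.AppendixC

end
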